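import Literature.Probability.LatticeModels.CurrentsPartialMonotonicity
import HarnessLib

/-!
# The second-moment step for the intersection of two independent double-current clusters (Aizenman–Duminil-Copin 2021, Lemma 4.4 / Lemma 6.2)

Topic `Literature/Probability/LatticeModels`. For edge couplings `K ≥ 0` on a finite simple graph `G`
(`WeightedCurrents.lean`; `ℝ≥0∞` current sums `Z[A] = ecurrentSum K A`, pair weights `epairWeight`, the
connection indicator `connInd v o (n₁,n₂) = 𝟙[v ∈ C_{n₁+n₂}(o)]` of `CurrentsPartialMonotonicity.lean`),
consider two independent double currents `(n₁,n₃)` with sources `({o,x}, ∅)` and `(n₂,n₄)` with sources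
`({o,z}, ∅)` — the measure `P^{ox,oz,∅,∅} = P^{ox,∅} ⊗ P^{oz,∅}` of Aizenman–Duminil-Copin 2021, §4.2 —
and, for a finite vertex set `A` (an annulus `Ann(m,M)` in the source), the number of intersection
sites `|𝓜| = #(C_{n₁+n₃}(o) ∩ C_{n₂+n₄}(o) ∩ A) = ∑_{v ∈ A} 𝟙[v ∈ C_{n₁+n₃}(o)] 𝟙[v ∈ C_{n₂+n₄}(o)]`.
This file proves, in un-normalised current-sum form, the three displayed steps of the second-moment
argument in the proof of

* M. Aizenman, H. Duminil-Copin, *Marginal triviality of the scaling limits of critical 4D Ising and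
  `φ⁴₄` models*, Ann. of Math. **194** (2021), arXiv:1912.07973, **Lemma 4.4** (conditional
  intersection property; the same computation is Lemma 6.2, unconditional) [AizenmanDuminilCopinAnnals2021]:
  "`E^{0x,0z,∅,∅}[|𝓜|] = ∑_{v ∈ Ann(m,M)} P^{0x,∅}[v ↔ 0] P^{0z,∅}[v ↔ 0] = ∑_v (⟨σ₀σ_v⟩⟨σ_vσ_x⟩/⟨σ₀σ_x⟩)(⟨σ₀σ_v⟩⟨σ_vσ_z⟩/⟨σ₀σ_z⟩)`",
  "`E^{0x,0z,∅,∅}[|𝓜|²] = ∑_{v,w ∈ Ann(m,M)} P^{0x,∅}[v,w ↔ 0] P^{0z,∅}[v,w ↔ 0]`" bounded with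
  Proposition A.3, and "The second moment (or Cauchy–Schwarz) inequality …
  `P^{0x,0z,∅,∅}[𝓜 ≠ ∅] ≥ E[|𝓜|]² / E[|𝓜|²]`".

With `W(p,q) = epairWeight K {o,x} ∅ p · epairWeight K {o,z} ∅ q` (`p = (n₁,n₃)`, `q = (n₂,n₄)`) and
`N(p,q) = ∑_{v ∈ A} 𝟙[v ∈ C_p(o)] 𝟙[v ∈ C_q(o)]` (so `E[|𝓜|^k] = ∑ W N^k / (Z[ox]Z[oz]Z[∅]²)`):

* `Current.tsum_prodWeight_mul_interCount` — **first moment**: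
  `∑ W N = ∑_{v ∈ A} (Z[xv]Z[ov]) · (Z[zv]Z[ov])` (the three-point identity twice);
* `Current.sq_mul_tsum_prodWeight_mul_interCount_sq_le` — **second moment**:
  `Z[∅]² ∑ W N² ≤ ∑_{v,w ∈ A} B_x(v,w) B_z(v,w)`, `B_x(v,w) = Z[ov]Z[vw]Z[wx] + Z[ow]Z[wv]Z[vx]`
  (Proposition A.3 twice);
* `Current.tsum_mul_sq_le_tsum_indicator_mul_tsum_sq` — the **second-moment (Cauchy–Schwarz)
  inequality** for `ℝ≥0∞`-weighted sums, `(∑ w n)² ≤ (∑ w 𝟙[n ≠ 0]) (∑ w n²)`, and its instance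
  `Current.tsum_prodWeight_mul_interCount_sq_le` for `W, N`, where `𝟙[N ≠ 0] = 𝟙[𝓜 ≠ ∅]`
  (`Current.interCount_ne_zero_iff`).

Everything is finite-volume and proved (no named fact); the two-point-function inputs (regularity,
infrared bound) that turn these sums into `B_L`'s in the source are not part of this file.

## References

* M. Aizenman, H. Duminil-Copin, Ann. of Math. 194 (2021), arXiv:1912.07973, §4.2, proof of Lemma 4.4
  (the displays for `E[|𝓜|]`, `E[|𝓜|²]` and the second-moment inequality) and §6.1, proof of Lemma 6.2
  [AizenmanDuminilCopinAnnals2021].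
-/

noncomputable section

open Finset Filter
open scoped symmDiff ENNReal

namespace Literature.Probability.LatticeModels

variable {V : Type*} [Fintype V] [DecidableEq V] {G : SimpleGraph V} [DecidableRel G.Adj]

namespace Current

variable {K : G.edgeFinset → ℝ}

/-! ### The second-moment inequality for weighted sums in `ℝ≥0∞` -/

/-- `2ab ≤ a² + b²` in `ℝ≥0∞`. [folklore] -/
theorem two_mul_mul_le_sq_add_sq (a b : ℝ≥0∞) : 2 * (a * b) ≤ a ^ 2 + b ^ 2 := by
  rcases le_total a b with h | h
  · obtain ⟨c, rfl⟩ := exists_add_of_le h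
    have : a ^ 2 + (a + c) ^ 2 = 2 * (a * (a + c)) + c ^ 2 := by ring
    rw [this]; exact le_self_add
  · obtain ⟨c, rfl⟩ := exists_add_of_le h
    have : (b + c) ^ 2 + b ^ 2 = 2 * ((b + c) * b) + c ^ 2 := by ring
    rw [this]; exact le_self_add

/-- The pointwise step: `2 nᵢ nⱼ ≤ 𝟙[nᵢ ≠ 0] nⱼ² + 𝟙[nⱼ ≠ 0] nᵢ²`. [folklore] -/
theorem two_mul_mul_le_indicator_mul_sq_add (a b : ℝ≥0∞) :
    2 * (a * b) ≤ (if a = 0 then 0 else 1) * b ^ 2 + (if b = 0 then 0 else 1) * a ^ 2 := by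
  by_cases ha : a = 0
  · simp [ha]
  by_cases hb : b = 0
  · simp [hb]
  rw [if_neg ha, if_neg hb, one_mul, one_mul, add_comm]
  exact two_mul_mul_le_sq_add_sq a b

/-- **The second-moment (Cauchy–Schwarz) inequality for weighted sums**: for `w, n : ι → ℝ≥0∞`,
`(∑ᵢ wᵢ nᵢ)² ≤ (∑ᵢ wᵢ 𝟙[nᵢ ≠ 0]) · (∑ᵢ wᵢ nᵢ²)`, i.e. `E[N]² ≤ P[N ≠ 0] E[N²]` for the weights `w`
(Aizenman–Duminil-Copin 2021, proof of Lemma 4.4: "The second moment (or Cauchy–Schwarz)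
inequality"). [cite: AizenmanDuminilCopinAnnals2021, arXiv:1912.07973 §4.2, proof of Lemma 4.4 (second-moment inequality)] -/
theorem tsum_mul_sq_le_tsum_indicator_mul_tsum_sq {ι : Type*} (w n : ι → ℝ≥0∞) :
    (∑' i, w i * n i) ^ 2 ≤ (∑' i, w i * (if n i = 0 then 0 else 1)) * ∑' i, w i * n i ^ 2 := by
  have h2 : (2 : ℝ≥0∞) ≠ 0 := two_ne_zero
  have h2' : (2 : ℝ≥0∞) ≠ ∞ := ENNReal.ofNat_ne_top
  rw [← ENNReal.mul_le_mul_iff_right h2 h2']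
  calc 2 * (∑' i, w i * n i) ^ 2
      = ∑' p : ι × ι, w p.1 * w p.2 * (2 * (n p.1 * n p.2)) := by
        rw [sq, tsum_mul_tsum_eq_tsum_prod, ← ENNReal.tsum_mul_left]
        exact tsum_congr fun p => by ring
    _ ≤ ∑' p : ι × ι, w p.1 * w p.2 *
          ((if n p.1 = 0 then 0 else 1) * n p.2 ^ 2 + (if n p.2 = 0 then 0 else 1) * n p.1 ^ 2) :=
        ENNReal.tsum_le_tsum fun p => mul_le_mul' le_rfl (two_mul_mul_le_indicator_mul_sq_add _ _)
    _ = ∑' p : ι × ι, (w p.1 * (if n p.1 = 0 then 0 else 1)) * (w p.2 * n p.2 ^ 2) +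
          ∑' p : ι × ι, (w p.1 * n p.1 ^ 2) * (w p.2 * (if n p.2 = 0 then 0 else 1)) := by
        rw [← ENNReal.tsum_add]
        exact tsum_congr fun p => by ring
    _ = (∑' i, w i * (if n i = 0 then 0 else 1)) * (∑' i, w i * n i ^ 2) +
          (∑' i, w i * n i ^ 2) * (∑' i, w i * (if n i = 0 then 0 else 1)) := by
        rw [tsum_mul_tsum_eq_tsum_prod, tsum_mul_tsum_eq_tsum_prod]
    _ = 2 * ((∑' i, w i * (if n i = 0 then 0 else 1)) * ∑' i, w i * n i ^ 2) := by ring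

/-! ### The intersection count of two independent double-current clusters -/

/-- The number of intersection sites in `A` of the clusters of `o` in two pairs of currents,
`N(p,q) = ∑_{v ∈ A} 𝟙[v ∈ C_{p₁+p₂}(o)] 𝟙[v ∈ C_{q₁+q₂}(o)] = |C_p(o) ∩ C_q(o) ∩ A|` (`|𝓜|` of
Aizenman–Duminil-Copin 2021, proof of Lemma 4.4, with `A = Ann(m,M)`), in `ℝ≥0∞`.
[cite: AizenmanDuminilCopinAnnals2021, arXiv:1912.07973 §4.2, proof of Lemma 4.4 (definition of 𝓜)] -/
def interCount (A : Finset V) (o : V) (p q : Current G × Current G) : ℝ≥0∞ :=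
  ∑ v ∈ A, connInd v o p * connInd v o q

/-- `N(p,q) ≠ 0` iff the two clusters of `o` meet inside `A` (`𝓜 ≠ ∅`). [folklore] -/
theorem interCount_ne_zero_iff (A : Finset V) (o : V) (p q : Current G × Current G) :
    interCount A o p q ≠ 0 ↔ ∃ v ∈ A, v ∈ (p.1 + p.2).cluster o ∧ v ∈ (q.1 + q.2).cluster o := by
  unfold interCount connInd
  rw [Ne, Finset.sum_eq_zero_iff, not_forall]
  constructor
  · rintro ⟨v, hv⟩
    rw [Classical.not_imp] at hv
    obtain ⟨hvA, hne⟩ := hv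
    refine ⟨v, hvA, ?_, ?_⟩
    · by_contra h; exact hne (by rw [if_neg h, zero_mul])
    · by_contra h; exact hne (by rw [if_neg h, mul_zero])
  · rintro ⟨v, hvA, hp, hq⟩
    refine ⟨v, fun h => ?_⟩
    have := h hvA
    rw [if_pos hp, if_pos hq, mul_one] at this
    exact one_ne_zero this

/-- The product weight of the two independent double currents `P^{ox,∅} ⊗ P^{oz,∅}` (un-normalised):
`W(p,q) = 1{∂p₁={o,x}}1{∂p₂=∅} w w · 1{∂q₁={o,z}}1{∂q₂=∅} w w`. [cite: AizenmanDuminilCopinAnnals2021, arXiv:1912.07973 §3.1, the product measures P^{A₁,…,A_i} (display before (3.10))] -/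
def prodWeight (K : G.edgeFinset → ℝ) (o x z : V) (pq : (Current G × Current G) × (Current G × Current G)) :
    ℝ≥0∞ :=
  epairWeight K ({o} ∆ {x}) ∅ pq.1 * epairWeight K ({o} ∆ {z}) ∅ pq.2

/-- Fubini for the product weight against a product function. [folklore] -/
theorem tsum_prodWeight_mul_mul (K : G.edgeFinset → ℝ) (o x z : V)
    (f g : Current G × Current G → ℝ≥0∞) :
    ∑' pq, prodWeight K o x z pq * (f pq.1 * g pq.2) =
      (∑' p, epairWeight K ({o} ∆ {x}) ∅ p * f p) * ∑' q, epairWeight K ({o} ∆ {z}) ∅ q * g q := by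
  rw [tsum_mul_tsum_eq_tsum_prod]
  exact tsum_congr fun pq => by unfold prodWeight; ring

/-- **First moment of the intersection count** (Aizenman–Duminil-Copin 2021, proof of Lemma 4.4,
first display: "`E^{0x,0z,∅,∅}[|𝓜|] = ∑_{v} P^{0x,∅}[v ↔ 0] P^{0z,∅}[v ↔ 0] = ∑_v (⟨σ₀σ_v⟩⟨σ_vσ_x⟩/⟨σ₀σ_x⟩)(⟨σ₀σ_v⟩⟨σ_vσ_z⟩/⟨σ₀σ_z⟩)`"),
un-normalised: `∑ W N = ∑_{v ∈ A} (Z[xv] Z[ov]) · (Z[zv] Z[ov])`.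
[cite: AizenmanDuminilCopinAnnals2021, arXiv:1912.07973 §4.2, proof of Lemma 4.4 (first moment of |𝓜|)] -/
theorem tsum_prodWeight_mul_interCount (hK : ∀ e, 0 ≤ K e) (A : Finset V) (o x z : V) :
    ∑' pq, prodWeight K o x z pq * interCount A o pq.1 pq.2 =
      ∑ v ∈ A, (ecurrentSum K ({x} ∆ {v}) * ecurrentSum K ({o} ∆ {v})) *
        (ecurrentSum K ({z} ∆ {v}) * ecurrentSum K ({o} ∆ {v})) := by
  unfold interCount
  simp_rw [Finset.mul_sum]
  rw [Summable.tsum_finsetSum (fun _ _ => ENNReal.summable)]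
  refine Finset.sum_congr rfl fun v _ => ?_
  rw [tsum_prodWeight_mul_mul K o x z (connInd v o) (connInd v o)]
  unfold connInd
  rw [tsum_epairWeight_mul_indicator_mem_cluster hK o x v, tsum_epairWeight_mul_indicator_mem_cluster hK o z v]

/-- The two-step bound of Proposition A.3 for a pair of intersection sites, named:
`B_x(v,w) = Z[ov]Z[vw]Z[wx] + Z[ow]Z[wv]Z[vx]`. [cite: AizenmanDuminilCopinAnnals2021, arXiv:1912.07973 Appendix A.2, Proposition A.3] -/
def twoStepBound (K : G.edgeFinset → ℝ) (o x v w : V) : ℝ≥0∞ :=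
  ecurrentSum K ({o} ∆ {v}) * ecurrentSum K ({v} ∆ {w}) * ecurrentSum K ({w} ∆ {x}) +
    ecurrentSum K ({o} ∆ {w}) * ecurrentSum K ({w} ∆ {v}) * ecurrentSum K ({v} ∆ {x})

/-- Proposition A.3 in the language of `connInd`:
`Z[∅] ∑ 1{ox}1{∅} w w 𝟙[v ∈ C(o)]𝟙[w ∈ C(o)] ≤ B_x(v,w)`. [cite: AizenmanDuminilCopinAnnals2021, arXiv:1912.07973 Appendix A.2, Proposition A.3] -/
theorem ecurrentSum_empty_mul_tsum_connInd_mul_connInd_le (hK : ∀ e, 0 ≤ K e) (o x v w : V) :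
    ecurrentSum K ∅ * ∑' p, epairWeight K ({o} ∆ {x}) ∅ p * (connInd v o p * connInd w o p) ≤
      twoStepBound K o x v w := by
  unfold connInd twoStepBound
  rw [add_comm]
  exact ecurrentSum_empty_mul_tsum_double_conn_le hK o x v w

/-- **Second moment of the intersection count** (Aizenman–Duminil-Copin 2021, proof of Lemma 4.4,
second and third displays: "`E^{0x,0z,∅,∅}[|𝓜|²] = ∑_{v,w} P^{0x,∅}[v,w ↔ 0] P^{0z,∅}[v,w ↔ 0]`" and the
insertion of Proposition A.3), un-normalised:
`Z[∅]² ∑ W N² ≤ ∑_{v,w ∈ A} B_x(v,w) B_z(v,w)`.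
[cite: AizenmanDuminilCopinAnnals2021, arXiv:1912.07973 §4.2, proof of Lemma 4.4 (second moment of |𝓜|)] -/
theorem sq_mul_tsum_prodWeight_mul_interCount_sq_le (hK : ∀ e, 0 ≤ K e) (A : Finset V) (o x z : V) :
    ecurrentSum K ∅ ^ 2 * ∑' pq, prodWeight K o x z pq * interCount A o pq.1 pq.2 ^ 2 ≤
      ∑ v ∈ A, ∑ w ∈ A, twoStepBound K o x v w * twoStepBound K o z v w := by
  -- expand the square and exchange sums
  have hexp : ∀ pq : (Current G × Current G) × (Current G × Current G),
      prodWeight K o x z pq * interCount A o pq.1 pq.2 ^ 2 =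
        ∑ v ∈ A, ∑ w ∈ A, prodWeight K o x z pq *
          ((connInd v o pq.1 * connInd w o pq.1) * (connInd v o pq.2 * connInd w o pq.2)) := by
    intro pq
    unfold interCount
    rw [sq, Finset.sum_mul_sum, Finset.mul_sum]
    refine Finset.sum_congr rfl fun v _ => ?_
    rw [Finset.mul_sum]
    exact Finset.sum_congr rfl fun w _ => by ring
  rw [tsum_congr hexp, Summable.tsum_finsetSum (fun _ _ => ENNReal.summable), Finset.mul_sum]
  refine Finset.sum_le_sum fun v _ => ?_
  rw [Summable.tsum_finsetSum (fun _ _ => ENNReal.summable), Finset.mul_sum]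
  refine Finset.sum_le_sum fun w _ => ?_
  rw [tsum_prodWeight_mul_mul K o x z (fun p => connInd v o p * connInd w o p)
    (fun q => connInd v o q * connInd w o q)]
  calc ecurrentSum K ∅ ^ 2 * ((∑' p, epairWeight K ({o} ∆ {x}) ∅ p * (connInd v o p * connInd w o p)) *
          ∑' q, epairWeight K ({o} ∆ {z}) ∅ q * (connInd v o q * connInd w o q))
      = (ecurrentSum K ∅ * ∑' p, epairWeight K ({o} ∆ {x}) ∅ p * (connInd v o p * connInd w o p)) *
          (ecurrentSum K ∅ * ∑' q, epairWeight K ({o} ∆ {z}) ∅ q * (connInd v o q * connInd w o q)) := by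
        ring
    _ ≤ twoStepBound K o x v w * twoStepBound K o z v w :=
        mul_le_mul' (ecurrentSum_empty_mul_tsum_connInd_mul_connInd_le hK o x v w)
          (ecurrentSum_empty_mul_tsum_connInd_mul_connInd_le hK o z v w)

/-- **The second-moment lower bound for the intersection event** (Aizenman–Duminil-Copin 2021, proof
of Lemma 4.4: "`P^{0x,0z,∅,∅}[𝓜 ≠ ∅] ≥ E[|𝓜|]²/E[|𝓜|²]`"), un-normalised and cross-multiplied:
`(∑ W N)² ≤ (∑ W 𝟙[N ≠ 0]) · (∑ W N²)`, with `𝟙[N ≠ 0] = 𝟙[C_{n₁+n₃}(o) ∩ C_{n₂+n₄}(o) ∩ A ≠ ∅]`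
(`interCount_ne_zero_iff`). [cite: AizenmanDuminilCopinAnnals2021, arXiv:1912.07973 §4.2, proof of Lemma 4.4 (second-moment inequality)] -/
theorem tsum_prodWeight_mul_interCount_sq_le (K : G.edgeFinset → ℝ) (A : Finset V) (o x z : V) :
    (∑' pq, prodWeight K o x z pq * interCount A o pq.1 pq.2) ^ 2 ≤
      (∑' pq, prodWeight K o x z pq * (if interCount A o pq.1 pq.2 = 0 then 0 else 1)) *
        ∑' pq, prodWeight K o x z pq * interCount A o pq.1 pq.2 ^ 2 :=
  tsum_mul_sq_le_tsum_indicator_mul_tsum_sq (prodWeight K o x z) fun pq => interCount A o pq.1 pq.2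

end Current

end Literature.Probability.LatticeModels
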